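import Summits.ValiantsHypothesis.ValiantsHypothesis.Theses.ProjectionStability
import Literature.Computability.AlgebraicComplexity.RankOneDeterminantalExpressionsProofs

/-!
# `UniqStep` / `UniqBase` (cruxes stmt-ValiantsHypothesis-17834 / -17836, route `ProjectionStability`):
# the coefficient-ONE normalisation of variable entries is load-bearing (negative-side support)

The route's uniqueness statements (`UniqBase`; `Uniq n`, `Uniq (n+1)` inside `UniqStep`, `OptStep`)
quantify over matrices with entries `X v` or `C c` (a variable carries coefficient exactly `1`); the
planner keeps "signed / toric projections (entries `c·x`) EXCLUDED". Sorry-free record of WHY, at the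
smallest level `n = 3`, size `7`: `A` = Grenet's projection of `per₃` (rows/columns
`s, u₀, u₁, u₂, v₀, v₁, v₂`), `B = A · F` with `F = 1 + X(1,0)·E_{u₀ s} − X(0,0)·E_{u₁ s}` the PURE
Koszul twist (the syzygy `X(0,0)X(1,0) − X(1,0)X(0,0) = 0` keeps row `s`; the new entries
`B u₀ s = X(1,0)`, `B u₁ s = -X(0,0)` land on zero entries of `A`; `det F = 1`). Both have determinant
`per₃`; `B` is a projection up to ONE sign, and `B` is not equivalent to `A` modulo
`GL₇(ℂ)² × permSymmetrySubst × transpose`: every `γ ∈ permSymmetrySubst ℂ 3` acts monomially on the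
variables, so coefficient matrices transform as `lin v ↦ c • P·(lin w A)·Q` with `v ↦ w` injective
(`γ` invertible); in `A` only the three `X(·,1)` have coefficient matrices of rank `2` (all others sit
in one row), in `B` the four variables `X(0,0), X(1,0), X(2,1), X(1,1)` have an invertible `2 × 2`
minor. The sign at `(u₁, s)` is not a diagonal coboundary (rows `u₀, u₁` share a column), so this is
NOT a refutation of `UniqBase`: it says any proof of `UniqBase` / `UniqStep` must use the coefficient-one
convention (equivalently, exclude that `B` is constant-gauge equivalent to an unsigned projection).
-/

noncomputable section

set_option linter.dupNamespace false

namespace Summit.ValiantsHypothesis.ValiantsHypothesis.Theorems.UniqStep.Negative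

open MvPolynomial Matrix
open scoped Kronecker
open Literature.Computability.AlgebraicComplexity

-- 49 entries of seven explicit `7 × 7` matrices in one declaration: default heartbeat budget exceeded
set_option maxHeartbeats 800000 in
/-- `Uniq 3` with SIGNED variable entries allowed (entries `X v`, `-X v` or `C c`; explicit size `7`)
is false: Grenet's projection `A` of `per₃` and its pure Koszul twist `B = A·F` (one entry `-X(0,0)`)
both have determinant `perPoly (Fin 3) ℂ`, and no `(P, Q, γ)`, `γ ∈ permSymmetrySubst ℂ 3`, maps `A`
to `B` or to `B` in transposed form (four variables of `B` have rank-`2` coefficient matrices, only three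
of `A` do). The coefficient-one normalisation in `UniqBase`/`UniqStep` is therefore load-bearing.
[folklore] -/
theorem uniq_three_false_with_signed_entries :
    ¬ ∀ A B : Matrix (Fin 7) (Fin 7) (MvPolynomial (Fin 3 × Fin 3) ℂ),
      (∀ i j, (∃ v, A i j = X v ∨ A i j = -X v) ∨ ∃ c, A i j = C c) →
      (∀ i j, (∃ v, B i j = X v ∨ B i j = -X v) ∨ ∃ c, B i j = C c) →
      A.det = perPoly (Fin 3) ℂ → B.det = perPoly (Fin 3) ℂ →
      ∃ (P Q : GL (Fin 7) ℂ) (γ : GL (Fin 3 × Fin 3) ℂ), γ ∈ permSymmetrySubst ℂ 3 ∧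
        (B = (P : Matrix (Fin 7) (Fin 7) ℂ).map C * Matrix.linSubstEntries γ A *
            (Q : Matrix (Fin 7) (Fin 7) ℂ).map C ∨
         B = (P : Matrix (Fin 7) (Fin 7) ℂ).map C * (Matrix.linSubstEntries γ A)ᵀ *
            (Q : Matrix (Fin 7) (Fin 7) ℂ).map C) := by
  intro hU
  -- ### the two representations `A`, `B` and the auxiliary unipotent / triangular matrices
  obtain ⟨gA, hgA⟩ : ∃ M : Matrix (Fin 7) (Fin 7) (MvPolynomial (Fin 3 × Fin 3) ℂ), M =
      !![0, X (0,0), X (1,0), X (2,0), 0, 0, 0;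
         0, 1, 0, 0, 0, X (2,1), X (1,1);
         0, 0, 1, 0, X (2,1), 0, X (0,1);
         0, 0, 0, 1, X (1,1), X (0,1), 0;
         X (0,2), 0, 0, 0, 1, 0, 0;
         X (1,2), 0, 0, 0, 0, 1, 0;
         X (2,2), 0, 0, 0, 0, 0, 1] := ⟨_, rfl⟩
  obtain ⟨gB, hgB⟩ : ∃ M : Matrix (Fin 7) (Fin 7) (MvPolynomial (Fin 3 × Fin 3) ℂ), M =
      !![0, X (0,0), X (1,0), X (2,0), 0, 0, 0;
         X (1,0), 1, 0, 0, 0, X (2,1), X (1,1);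
         -X (0,0), 0, 1, 0, X (2,1), 0, X (0,1);
         0, 0, 0, 1, X (1,1), X (0,1), 0;
         X (0,2), 0, 0, 0, 1, 0, 0;
         X (1,2), 0, 0, 0, 0, 1, 0;
         X (2,2), 0, 0, 0, 0, 0, 1] := ⟨_, rfl⟩
  obtain ⟨E1, hE1⟩ : ∃ M : Matrix (Fin 7) (Fin 7) (MvPolynomial (Fin 3 × Fin 3) ℂ), M =
      !![1, 0, 0, 0, 0, 0, 0; 0, 1, 0, 0, 0, -X (2,1), -X (1,1); 0, 0, 1, 0, -X (2,1), 0, -X (0,1);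
         0, 0, 0, 1, -X (1,1), -X (0,1), 0; 0, 0, 0, 0, 1, 0, 0; 0, 0, 0, 0, 0, 1, 0;
         0, 0, 0, 0, 0, 0, 1] := ⟨_, rfl⟩
  obtain ⟨E2, hE2⟩ : ∃ M : Matrix (Fin 7) (Fin 7) (MvPolynomial (Fin 3 × Fin 3) ℂ), M =
      !![1, 0, 0, 0, 0, 0, 0; 0, 1, 0, 0, 0, 0, 0; 0, 0, 1, 0, 0, 0, 0; 0, 0, 0, 1, 0, 0, 0;
         -X (0,2), 0, 0, 0, 1, 0, 0; -X (1,2), 0, 0, 0, 0, 1, 0; -X (2,2), 0, 0, 0, 0, 0, 1] := ⟨_, rfl⟩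
  obtain ⟨A1, hA1⟩ : ∃ M : Matrix (Fin 7) (Fin 7) (MvPolynomial (Fin 3 × Fin 3) ℂ), M =
      !![0, X (0,0), X (1,0), X (2,0), -(X (1,0) * X (2,1) + X (2,0) * X (1,1)),
           -(X (0,0) * X (2,1) + X (2,0) * X (0,1)), -(X (0,0) * X (1,1) + X (1,0) * X (0,1));
         0, 1, 0, 0, 0, 0, 0; 0, 0, 1, 0, 0, 0, 0; 0, 0, 0, 1, 0, 0, 0;
         X (0,2), 0, 0, 0, 1, 0, 0; X (1,2), 0, 0, 0, 0, 1, 0; X (2,2), 0, 0, 0, 0, 0, 1] := ⟨_, rfl⟩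
  obtain ⟨T, hT⟩ : ∃ M : Matrix (Fin 7) (Fin 7) (MvPolynomial (Fin 3 × Fin 3) ℂ), M =
      !![perPoly (Fin 3) ℂ, X (0,0), X (1,0), X (2,0), -(X (1,0) * X (2,1) + X (2,0) * X (1,1)),
           -(X (0,0) * X (2,1) + X (2,0) * X (0,1)), -(X (0,0) * X (1,1) + X (1,0) * X (0,1));
         0, 1, 0, 0, 0, 0, 0; 0, 0, 1, 0, 0, 0, 0; 0, 0, 0, 1, 0, 0, 0;
         0, 0, 0, 0, 1, 0, 0; 0, 0, 0, 0, 0, 1, 0; 0, 0, 0, 0, 0, 0, 1] := ⟨_, rfl⟩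
  obtain ⟨F, hF⟩ : ∃ M : Matrix (Fin 7) (Fin 7) (MvPolynomial (Fin 3 × Fin 3) ℂ), M =
      !![1, 0, 0, 0, 0, 0, 0; X (1,0), 1, 0, 0, 0, 0, 0; -X (0,0), 0, 1, 0, 0, 0, 0;
         0, 0, 0, 1, 0, 0, 0; 0, 0, 0, 0, 1, 0, 0; 0, 0, 0, 0, 0, 1, 0; 0, 0, 0, 0, 0, 0, 1] := ⟨_, rfl⟩
  have p3 : perPoly (Fin 3) ℂ = X (0,0) * (X (1,1) * X (2,2) + X (2,1) * X (1,2))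
      + X (1,0) * (X (0,1) * X (2,2) + X (2,1) * X (0,2))
      + X (2,0) * (X (0,1) * X (1,2) + X (1,1) * X (0,2)) := by
    simp [perPoly, permanent_fin_three, Matrix.mvPolynomialX_apply]
  have coeff_one_single : ∀ v : Fin 3 × Fin 3,
      (1 : MvPolynomial (Fin 3 × Fin 3) ℂ).coeff (Finsupp.single v 1) = 0 := fun v => by
    rw [MvPolynomial.coeff_one, if_neg]
    exact Ne.symm (Finsupp.single_ne_zero.mpr one_ne_zero)
  -- ### ONE inspection of the 49 entries: products, triangularity, shapes of `A` and `B`, and the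
  -- rows in which the variable `X w` occurs in `A` (one row unless `w.2 = 1`)
  have big : ∀ i j : Fin 7,
      ((gA * E1) i j = A1 i j ∧ (A1 * E2) i j = T i j ∧ (gA * F) i j = gB i j) ∧
      ((j < i → E1 i j = 0) ∧ (j < i → T i j = 0) ∧ (i < j → F i j = 0) ∧ (i < j → E2 i j = 0)) ∧
      (gA i j = 0 ∨ gA i j = 1 ∨ ∃ w, gA i j = X w) ∧
      (gB i j = 0 ∨ gB i j = 1 ∨ (∃ w, gB i j = X w) ∨ ∃ w, gB i j = -X w) ∧
      (∀ w : Fin 3 × Fin 3, (gA i j).coeff (Finsupp.single w 1) ≠ 0 →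
        i = ![![(0 : Fin 7), 2, 4], ![0, 1, 5], ![0, 1, 6]] w.1 w.2 ∨
        (w.2 = 1 ∧ i = ![![(1 : Fin 7), 3, 5], ![2, 3, 4], ![3, 2, 5]] w.1 w.2)) := by
    intro i j
    rw [hgA, hgB, hE1, hE2, hA1, hT, hF, p3]
    fin_cases i <;> fin_cases j <;> refine ⟨⟨?_, ?_, ?_⟩, ⟨?_, ?_, ?_, ?_⟩, ?_, ?_, ?_⟩ <;>
      simp [Matrix.mul_apply, Fin.sum_univ_seven, MvPolynomial.coeff_X, Finsupp.single_left_inj,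
        coeff_one_single]
    all_goals ring
  -- ### determinants: `det A = det B = per₃`
  have det_gA : gA.det = perPoly (Fin 3) ℂ := by
    have h1 : gA * E1 = A1 := Matrix.ext fun i j => (big i j).1.1
    have h2 : A1 * E2 = T := Matrix.ext fun i j => (big i j).1.2.1
    have dE1 : E1.det = 1 := by
      rw [Matrix.det_of_upperTriangular (M := E1) fun i j hij => (big i j).2.1.1 hij, Fin.prod_univ_seven,
        hE1]
      simp
    have dE2 : E2.det = 1 := by
      rw [Matrix.det_of_lowerTriangular E2 (fun i j hij => (big i j).2.1.2.2.2 hij),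
        Fin.prod_univ_seven, hE2]
      simp
    have dT : T.det = perPoly (Fin 3) ℂ := by
      rw [Matrix.det_of_upperTriangular (M := T) fun i j hij => (big i j).2.1.2.1 hij, Fin.prod_univ_seven,
        hT]
      simp
    have h := congrArg Matrix.det h2
    rwa [← h1, Matrix.det_mul, Matrix.det_mul, dE1, dE2, dT, mul_one, mul_one] at h
  have det_gB : gB.det = perPoly (Fin 3) ℂ := by
    have h1 : gA * F = gB := Matrix.ext fun i j => (big i j).1.2.2
    have dF : F.det = 1 := by
      rw [Matrix.det_of_lowerTriangular F (fun i j hij => (big i j).2.1.2.2.1 hij),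
        Fin.prod_univ_seven, hF]
      simp
    rw [← h1, Matrix.det_mul, det_gA, dF, mul_one]
  -- ### the entry predicates (`A` is an honest projection, `B` has one signed entry)
  have toSgn : ∀ p : MvPolynomial (Fin 3 × Fin 3) ℂ,
      (p = 0 ∨ p = 1 ∨ (∃ w, p = X w) ∨ ∃ w, p = -X w) →
      (∃ v, p = X v ∨ p = -X v) ∨ ∃ c, p = C c := by
    rintro p (rfl | rfl | ⟨w, rfl⟩ | ⟨w, rfl⟩)
    · exact Or.inr ⟨0, by simp⟩
    · exact Or.inr ⟨1, by simp⟩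
    · exact Or.inl ⟨w, Or.inl rfl⟩
    · exact Or.inl ⟨w, Or.inr rfl⟩
  have gA_sgn : ∀ i j, (∃ v, gA i j = X v ∨ gA i j = -X v) ∨ ∃ c, gA i j = C c := fun i j =>
    toSgn _ (by rcases (big i j).2.2.1 with h | h | h <;> simp [h])
  have gB_sgn : ∀ i j, (∃ v, gB i j = X v ∨ gB i j = -X v) ∨ ∃ c, gB i j = C c := fun i j =>
    toSgn _ (big i j).2.2.2.1
  -- ### every realised symmetry of `per₃` is a monomial substitution of the variables
  have rm_mul : ∀ {ι : Type} [Fintype ι] [DecidableEq ι] {M N : Matrix ι ι ℂ},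
      (∀ i, ∃ (j : ι) (c : ℂ), ∀ j', M i j' = if j' = j then c else 0) →
      (∀ i, ∃ (j : ι) (c : ℂ), ∀ j', N i j' = if j' = j then c else 0) →
      ∀ i, ∃ (j : ι) (c : ℂ), ∀ j', (M * N) i j' = if j' = j then c else 0 := by
    intro ι _ _ M N hM hN i
    obtain ⟨j, c, hj⟩ := hM i
    obtain ⟨l, d, hl⟩ := hN j
    refine ⟨l, c * d, fun j' => ?_⟩
    simp only [Matrix.mul_apply, hj, ite_mul, zero_mul, Finset.sum_ite_eq', Finset.mem_univ, if_true,
      hl, mul_ite, mul_zero]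
  have rm_diag : ∀ {ι : Type} [DecidableEq ι] (d : ι → ℂ),
      ∀ i, ∃ (j : ι) (c : ℂ), ∀ j', Matrix.diagonal d i j' = if j' = j then c else 0 := by
    intro ι _ d i
    refine ⟨i, d i, fun j' => ?_⟩
    by_cases h : j' = i
    · subst h; simp
    · simp [h, Matrix.diagonal_apply_ne _ (Ne.symm h)]
  have rm_perm : ∀ {ι : Type} [DecidableEq ι] (π : Equiv.Perm ι),
      ∀ i, ∃ (j : ι) (c : ℂ), ∀ j', π.permMatrix ℂ i j' = if j' = j then c else 0 := fun π i =>
    ⟨π i, 1, fun j' => by simp [Equiv.Perm.permMatrix, PEquiv.toMatrix_apply, Equiv.toPEquiv_apply, eq_comm]⟩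
  have inv_perm : ∀ {ι : Type} [Fintype ι] [DecidableEq ι] (π : Equiv.Perm ι),
      (π.permMatrix ℂ)⁻¹ = π⁻¹.permMatrix ℂ := by
    intro ι _ _ π
    apply Matrix.inv_eq_right_inv
    rw [← Matrix.permMatrix_mul, inv_mul_cancel, Matrix.permMatrix_one]
  have rm_kron : ∀ {ι κ : Type} [DecidableEq ι] [DecidableEq κ] {M : Matrix ι ι ℂ},
      (∀ i, ∃ (j : ι) (c : ℂ), ∀ j', M i j' = if j' = j then c else 0) →
      (∀ i, ∃ (j : ι × κ) (c : ℂ), ∀ j', (M ⊗ₖ (1 : Matrix κ κ ℂ)) i j' = if j' = j then c else 0) ∧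
      (∀ i, ∃ (j : κ × ι) (c : ℂ), ∀ j', ((1 : Matrix κ κ ℂ) ⊗ₖ M) i j' = if j' = j then c else 0) := by
    intro ι κ _ _ M hM
    constructor
    · rintro ⟨i, k⟩
      obtain ⟨j, c, hj⟩ := hM i
      refine ⟨(j, k), c, ?_⟩
      rintro ⟨j', k'⟩
      simp only [Matrix.kronecker_apply, hj, Matrix.one_apply, Prod.mk.injEq]
      by_cases h1 : j' = j <;> by_cases h2 : k = k' <;> simp [h1, h2, eq_comm]
    · rintro ⟨k, i⟩
      obtain ⟨j, c, hj⟩ := hM i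
      refine ⟨(k, j), c, ?_⟩
      rintro ⟨k', j'⟩
      simp only [Matrix.kronecker_apply, hj, Matrix.one_apply, Prod.mk.injEq]
      by_cases h1 : j' = j <;> by_cases h2 : k = k' <;> simp [h1, h2, eq_comm]
  have rm_mono : ∀ {m : ℕ} {g : GL (Fin m) ℂ}, g ∈ monomialSubgroup ℂ m →
      ∀ i, ∃ (j : Fin m) (c : ℂ), ∀ j', (g : Matrix (Fin m) (Fin m) ℂ) i j' = if j' = j then c else 0 := by
    intro m g hg
    induction hg using Subgroup.closure_induction'' with
    | mem x hx =>
      rcases hx with ⟨π, hπ⟩ | ⟨d, hd⟩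
      · rw [hπ]; exact rm_perm π
      · rw [hd]; exact rm_diag d
    | inv_mem x hx =>
      rcases hx with ⟨π, hπ⟩ | ⟨d, hd⟩
      · rw [Matrix.coe_units_inv, hπ, inv_perm]; exact rm_perm _
      · rw [Matrix.coe_units_inv, hd, Matrix.inv_diagonal]; exact rm_diag _
    | one => simpa using rm_diag (fun _ : Fin m => (1 : ℂ))
    | mul x y _ _ hx hy => rw [Units.val_mul]; exact rm_mul hx hy
  have rm_symm : ∀ {γ : GL (Fin 3 × Fin 3) ℂ}, γ ∈ permSymmetrySubst ℂ 3 →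
      ∀ i, ∃ (j : Fin 3 × Fin 3) (c : ℂ), ∀ j',
        (γ : Matrix (Fin 3 × Fin 3) (Fin 3 × Fin 3) ℂ) i j' = if j' = j then c else 0 := by
    have hleft : ∀ {γ : GL (Fin 3 × Fin 3) ℂ}, γ ∈ leftMonomialSubst ℂ 3 →
        ∀ i, ∃ (j : Fin 3 × Fin 3) (c : ℂ), ∀ j',
          (γ : Matrix (Fin 3 × Fin 3) (Fin 3 × Fin 3) ℂ) i j' = if j' = j then c else 0 := by
      intro γ hγ
      induction hγ using Subgroup.closure_induction'' with
      | mem x hx =>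
        obtain ⟨g, hg, hx⟩ := hx
        rw [hx]; exact (rm_kron (rm_mono hg)).1
      | inv_mem x hx =>
        obtain ⟨g, hg, hx⟩ := hx
        rw [Matrix.coe_units_inv, hx, Matrix.inv_kronecker, inv_one, ← Matrix.coe_units_inv]
        exact (rm_kron (rm_mono (Subgroup.inv_mem _ hg))).1
      | one => simpa using rm_diag (fun _ : Fin 3 × Fin 3 => (1 : ℂ))
      | mul x y _ _ hx hy => rw [Units.val_mul]; exact rm_mul hx hy
    have hright : ∀ {γ : GL (Fin 3 × Fin 3) ℂ}, γ ∈ rightMonomialSubst ℂ 3 →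
        ∀ i, ∃ (j : Fin 3 × Fin 3) (c : ℂ), ∀ j',
          (γ : Matrix (Fin 3 × Fin 3) (Fin 3 × Fin 3) ℂ) i j' = if j' = j then c else 0 := by
      intro γ hγ
      induction hγ using Subgroup.closure_induction'' with
      | mem x hx =>
        obtain ⟨g, hg, hx⟩ := hx
        rw [hx]; exact (rm_kron (rm_mono hg)).2
      | inv_mem x hx =>
        obtain ⟨g, hg, hx⟩ := hx
        rw [Matrix.coe_units_inv, hx, Matrix.inv_kronecker, inv_one, ← Matrix.coe_units_inv]
        exact (rm_kron (rm_mono (Subgroup.inv_mem _ hg))).2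
      | one => simpa using rm_diag (fun _ : Fin 3 × Fin 3 => (1 : ℂ))
      | mul x y _ _ hx hy => rw [Units.val_mul]; exact rm_mul hx hy
    intro γ hγ
    induction hγ using Subgroup.closure_induction'' with
    | mem x hx =>
      rcases hx with (hx | hx) | hx
      · exact hleft hx
      · exact hright hx
      · have hx' : (x : Matrix (Fin 3 × Fin 3) (Fin 3 × Fin 3) ℂ) =
            Equiv.Perm.permMatrix ℂ (Equiv.prodComm (Fin 3) (Fin 3)) := hx
        rw [hx']; exact rm_perm _
    | inv_mem x hx =>
      rcases hx with (hx | hx) | hx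
      · exact hleft (Subgroup.inv_mem _ hx)
      · exact hright (Subgroup.inv_mem _ hx)
      · have hx' : (x : Matrix (Fin 3 × Fin 3) (Fin 3 × Fin 3) ℂ) =
            Equiv.Perm.permMatrix ℂ (Equiv.prodComm (Fin 3) (Fin 3)) := hx
        rw [Matrix.coe_units_inv, hx', inv_perm]; exact rm_perm _
    | one => simpa using rm_diag (fun _ : Fin 3 × Fin 3 => (1 : ℂ))
    | mul x y _ _ hx hy => rw [Units.val_mul]; exact rm_mul hx hy
  -- ### linear parts (coefficient matrices of the variables)
  obtain ⟨lin, hlin⟩ : ∃ f : Fin 3 × Fin 3 → Matrix (Fin 7) (Fin 7) (MvPolynomial (Fin 3 × Fin 3) ℂ) →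
      Matrix (Fin 7) (Fin 7) ℂ, ∀ v M, f v M = Matrix.of fun i j => (M i j).coeff (Finsupp.single v 1) :=
    ⟨_, fun _ _ => rfl⟩
  have lin_C_mul : ∀ v (P : Matrix (Fin 7) (Fin 7) ℂ) M, lin v (P.map C * M) = P * lin v M := by
    intro v P M
    apply Matrix.ext; intro i j
    simp [hlin, Matrix.mul_apply, MvPolynomial.coeff_sum, MvPolynomial.coeff_C_mul]
  have lin_mul_C : ∀ v M (Q : Matrix (Fin 7) (Fin 7) ℂ), lin v (M * Q.map C) = lin v M * Q := by
    intro v M Q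
    apply Matrix.ext; intro i j
    have hc : ∀ (p : MvPolynomial (Fin 3 × Fin 3) ℂ) (a : ℂ),
        (p * C a).coeff (Finsupp.single v 1) = p.coeff (Finsupp.single v 1) * a := fun p a => by
      rw [mul_comm, MvPolynomial.coeff_C_mul, mul_comm]
    simp [hlin, Matrix.mul_apply, MvPolynomial.coeff_sum, hc]
  have lin_transpose : ∀ v M, lin v Mᵀ = (lin v M)ᵀ := fun v M => by
    apply Matrix.ext; intro i j; simp [hlin]
  -- a linear substitution `Γ` acts on the linear parts of `A` through the rows of `Γ`
  have lin_subst : ∀ (Γ : Matrix (Fin 3 × Fin 3) (Fin 3 × Fin 3) ℂ) (v : Fin 3 × Fin 3),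
      lin v (gA.map (linSubst (Fin 3 × Fin 3) ℂ Γ)) = ∑ w, Γ v w • lin w gA := by
    intro Γ v
    apply Matrix.ext; intro i j
    simp only [hlin, Matrix.map_apply, Matrix.of_apply, Matrix.sum_apply, Matrix.smul_apply, smul_eq_mul]
    rcases (big i j).2.2.1 with h | h | ⟨w, h⟩ <;> rw [h]
    · simp
    · simp [coeff_one_single]
    · simp [linSubst, MvPolynomial.coeff_sum, MvPolynomial.coeff_X, Finsupp.single_left_inj]
  -- ### rank at most one: factoring through `ℂ¹`
  have rk_map : ∀ {N : Matrix (Fin 7) (Fin 7) ℂ} (P Q : Matrix (Fin 7) (Fin 7) ℂ) (c : ℂ),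
      (∃ (U : Matrix (Fin 7) (Fin 1) ℂ) (V : Matrix (Fin 1) (Fin 7) ℂ), N = U * V) →
      (∃ (U : Matrix (Fin 7) (Fin 1) ℂ) (V : Matrix (Fin 1) (Fin 7) ℂ), P * (c • N) * Q = U * V) ∧
      (∃ (U : Matrix (Fin 7) (Fin 1) ℂ) (V : Matrix (Fin 1) (Fin 7) ℂ), P * (c • N)ᵀ * Q = U * V) := by
    rintro N P Q c ⟨U, V, rfl⟩
    refine ⟨⟨P * (c • U), V * Q, ?_⟩, ⟨P * Vᵀ, (c • U)ᵀ * Q, ?_⟩⟩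
    · rw [← Matrix.smul_mul, Matrix.mul_assoc, Matrix.mul_assoc, Matrix.mul_assoc]
    · rw [← Matrix.smul_mul, Matrix.transpose_mul, Matrix.mul_assoc, Matrix.mul_assoc, Matrix.mul_assoc]
  have rk_rows : ∀ {N : Matrix (Fin 7) (Fin 7) ℂ} (p : Fin 7),
      (∀ i, i ≠ p → ∀ j, N i j = 0) →
      ∃ (U : Matrix (Fin 7) (Fin 1) ℂ) (V : Matrix (Fin 1) (Fin 7) ℂ), N = U * V := by
    intro N p h
    refine ⟨Matrix.of fun i _ => if i = p then 1 else 0, Matrix.of fun _ j => N p j, ?_⟩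
    apply Matrix.ext; intro i j
    simp only [Matrix.mul_apply, Fin.sum_univ_one, Matrix.of_apply]
    by_cases hip : i = p
    · subst hip; simp
    · simp [hip, h i hip j]
  have rk_minor : ∀ {N : Matrix (Fin 7) (Fin 7) ℂ} (r c : Fin 2 → Fin 7),
      (∃ (U : Matrix (Fin 7) (Fin 1) ℂ) (V : Matrix (Fin 1) (Fin 7) ℂ), N = U * V) →
      (N.submatrix r c).det = 0 := by
    rintro N r c ⟨U, V, rfl⟩
    simp [Matrix.det_fin_two, Matrix.mul_apply]; ring
  -- every linear part `lin w A` with `w.2 ≠ 1` is supported in ONE row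
  have rk_gA : ∀ w : Fin 3 × Fin 3, w.2 ≠ 1 →
      ∃ (U : Matrix (Fin 7) (Fin 1) ℂ) (V : Matrix (Fin 1) (Fin 7) ℂ), lin w gA = U * V := by
    intro w hw
    refine rk_rows (![![(0 : Fin 7), 2, 4], ![0, 1, 5], ![0, 1, 6]] w.1 w.2) fun i hp j => ?_
    rw [hlin, Matrix.of_apply]
    by_contra h
    rcases (big i j).2.2.2.2 w h with h' | ⟨h', -⟩
    exacts [hp h', hw h']
  -- the four variables of `B` with an invertible `2 × 2` minor in their coefficient matrix
  have rk_gB : ∀ v : Fin 3 × Fin 3, (v = (0,0) ∨ v = (1,0) ∨ v = (2,1) ∨ v = (1,1)) →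
      ¬ ∃ (U : Matrix (Fin 7) (Fin 1) ℂ) (V : Matrix (Fin 1) (Fin 7) ℂ), lin v gB = U * V := by
    rintro v hv hUV
    rcases hv with rfl | rfl | rfl | rfl
    · have h1 : ((lin (0,0) gB).submatrix ![0, 2] ![1, 0]).det = -1 := by
        rw [hlin, hgB]; simp [Matrix.det_fin_two, MvPolynomial.coeff_X]
      rw [rk_minor _ _ hUV] at h1; norm_num at h1
    · have h1 : ((lin (1,0) gB).submatrix ![0, 1] ![2, 0]).det = 1 := by
        rw [hlin, hgB]; simp [Matrix.det_fin_two, MvPolynomial.coeff_X]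
      rw [rk_minor _ _ hUV] at h1; norm_num at h1
    · have h1 : ((lin (2,1) gB).submatrix ![1, 2] ![5, 4]).det = 1 := by
        rw [hlin, hgB]; simp [Matrix.det_fin_two, MvPolynomial.coeff_X]
      rw [rk_minor _ _ hUV] at h1; norm_num at h1
    · have h1 : ((lin (1,1) gB).submatrix ![1, 3] ![6, 4]).det = 1 := by
        rw [hlin, hgB]; simp [Matrix.det_fin_two, MvPolynomial.coeff_X]
      rw [rk_minor _ _ hUV] at h1; norm_num at h1
  -- ### conclusion
  obtain ⟨P, Q, γ, hγ, hPQ⟩ := hU gA gB gA_sgn gB_sgn det_gA det_gB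
  -- the γ-row of each of the four variables points at a variable `w` of `A` with `w.2 = 1`
  have step : ∀ v : Fin 3 × Fin 3, (v = (0,0) ∨ v = (1,0) ∨ v = (2,1) ∨ v = (1,1)) →
      ∃ (w : Fin 3 × Fin 3) (c : ℂ),
        (∀ j', (γ : Matrix (Fin 3 × Fin 3) (Fin 3 × Fin 3) ℂ) v j' = if j' = w then c else 0) ∧
        w.2 = 1 := by
    intro v hv
    obtain ⟨w, c, hrow⟩ := rm_symm hγ v
    refine ⟨w, c, hrow, ?_⟩
    by_contra hw
    have key : lin v (Matrix.linSubstEntries γ gA) = c • lin w gA := by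
      rw [Matrix.linSubstEntries, lin_subst]
      simp only [hrow, ite_smul, zero_smul, Finset.sum_ite_eq', Finset.mem_univ, if_true]
    apply rk_gB v hv
    rcases hPQ with hB | hB
    · rw [hB, lin_mul_C, lin_C_mul, key]
      exact (rk_map _ _ c (rk_gA w hw)).1
    · rw [hB, lin_mul_C, lin_C_mul, lin_transpose, key]
      exact (rk_map _ _ c (rk_gA w hw)).2
  -- distinct variables have distinct targets (`γ` is invertible)
  have inj : ∀ {i i' w : Fin 3 × Fin 3} {c c' : ℂ}, i ≠ i' →
      (∀ j', (γ : Matrix (Fin 3 × Fin 3) (Fin 3 × Fin 3) ℂ) i j' = if j' = w then c else 0) →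
      (∀ j', (γ : Matrix (Fin 3 × Fin 3) (Fin 3 × Fin 3) ℂ) i' j' = if j' = w then c' else 0) →
      False := by
    intro i i' w c c' hii' hi hi'
    have hmul : (γ : Matrix (Fin 3 × Fin 3) (Fin 3 × Fin 3) ℂ) *
        ((γ⁻¹ : GL (Fin 3 × Fin 3) ℂ) : Matrix (Fin 3 × Fin 3) (Fin 3 × Fin 3) ℂ) = 1 := by
      rw [← Units.val_mul, mul_inv_cancel, Units.val_one]
    have e1 := congrFun (congrFun hmul i) i
    have e2 := congrFun (congrFun hmul i') i
    have e3 := congrFun (congrFun hmul i') i'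
    rw [Matrix.mul_apply, Matrix.one_apply_eq] at e1 e3
    rw [Matrix.mul_apply, Matrix.one_apply_ne (Ne.symm hii')] at e2
    simp only [hi, hi', ite_mul, zero_mul, Finset.sum_ite_eq', Finset.mem_univ, if_true] at e1 e2 e3
    rcases mul_eq_zero.mp e2 with h | h
    · rw [h, zero_mul] at e3; exact zero_ne_one e3
    · rw [h, mul_zero] at e1; exact zero_ne_one e1
  obtain ⟨w1, c1, hr1, hw1⟩ := step (0,0) (Or.inl rfl)
  obtain ⟨w2, c2, hr2, hw2⟩ := step (1,0) (Or.inr (Or.inl rfl))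
  obtain ⟨w3, c3, hr3, hw3⟩ := step (2,1) (Or.inr (Or.inr (Or.inl rfl)))
  obtain ⟨w4, c4, hr4, hw4⟩ := step (1,1) (Or.inr (Or.inr (Or.inr rfl)))
  have h12 : w1 ≠ w2 := fun h => by subst h; exact inj (by decide) hr1 hr2
  have h13 : w1 ≠ w3 := fun h => by subst h; exact inj (by decide) hr1 hr3
  have h14 : w1 ≠ w4 := fun h => by subst h; exact inj (by decide) hr1 hr4
  have h23 : w2 ≠ w3 := fun h => by subst h; exact inj (by decide) hr2 hr3
  have h24 : w2 ≠ w4 := fun h => by subst h; exact inj (by decide) hr2 hr4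
  have h34 : w3 ≠ w4 := fun h => by subst h; exact inj (by decide) hr3 hr4
  -- four distinct variables `w` with `w.2 = 1`: impossible in `Fin 3 × Fin 3`
  have kk : ∀ {a b : Fin 3 × Fin 3}, a ≠ b → a.2 = 1 → b.2 = 1 → (a.1 : ℕ) ≠ b.1 :=
    fun h ha hb e => h (Prod.ext (Fin.ext e) (ha.trans hb.symm))
  have k12 := kk h12 hw1 hw2; have k13 := kk h13 hw1 hw3; have k14 := kk h14 hw1 hw4
  have k23 := kk h23 hw2 hw3; have k24 := kk h24 hw2 hw4; have k34 := kk h34 hw3 hw4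
  have l1 := w1.1.isLt; have l2 := w2.1.isLt; have l3 := w3.1.isLt; have l4 := w4.1.isLt
  omega

end Summit.ValiantsHypothesis.ValiantsHypothesis.Theorems.UniqStep.Negative

end
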